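import Summits.Ventures.YMGap.RobustBall.StarWindowZdWRowsSU2
import Summits.Ventures.YMGap.RobustBall.TierTwoCellsSU2Dim3
import Summits.Ventures.YMGap.RobustBall.TierTwoCellsSU2Var
import Summits.Ventures.YMGap.RobustBall.PeriodisedDLRSummable
import HarnessLib

/-!
# Venture YMGap, track ROBUST-BALL (Y2) — «C-ONE-W» CELLS, `SU(2)`: on every cell of the tier-2 tables (`ℤ⁴` quarter modulus up to `β_W = 1/3`,
# `ℤ³` up to `1/2`, `ℤ⁴` variance form up to `1/5`) the van Hove (periodised torus) limit of every member IS its one DLR state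

HONEST FRAMING. WHAT THIS IS: a venture file (cell `pub-ymgap`, track Y2 ROBUST-BALL, seat ds-2): one-line consequences of `oneState_onBallZdW` /
`exists_limitState_onBallZdW` (`PeriodisedDLRSummable.lean`) and the landed `SU(2)` tier-2 mass-gap cells `su2_massGapOnBallZdW_star_<cell>`
(`ℤ⁴`: (1/10,.173) (1/8,.148) (1/6,.111) (1/5,.086) (1/4,.054) (3/10,.027) (1/3,.011); `StarWindowZdWRowsSU2.lean`), `su2_massGapOnBallZdW_dim3_star_<cell>`
(`ℤ³`: (1/4,.114) (3/10,.090) (2/5,.049) (1/2,.017); `TierTwoCellsSU2Dim3.lean`) and `su2_massGapOnBallZdW_starVar_<cell>` (`ℤ⁴` variance form: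
(1/16,.308) (1/10,.256) (1/8,.222) (1/6,.169) (1/5,.128); `TierTwoCellsSU2Var.lean`): for EVERY member `W` of the cell's ball `MemBallZdW (1/100) (2ε) ε`
(gauge-invariant summable perturbations of `SU(2)` Wilson of ARBITRARY range; tree coupling `β_W/2`), EVERY infinite-volume limit state of the
perturbed torus states of its periodised family (`periodisedFamilyS`: periodisation through the truncations `truncZd (L/4) 0 W`; rb-p2's
`perturbedLimitPoints`) IS the one DLR state, and such limit states exist (`su2_vanHove_oneState_star_<cell>`, `…_dim3_star_<cell>`,
`…_starVar_<cell>`; `su2_vanHove_oneState_star_upTo_oneThird` for all `0 ≤ β_W ≤ 1/3` on the `1/3` ball). The MASSIVE reading of these limit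
states rides with the massive cells (`TierTwoMassiveSU2.lean`). WHAT THIS IS NOT: strong-coupling LATTICE statements; no rate of convergence for
the van Hove limit; nothing about the continuum, a transfer-matrix gap or the Millennium problem.
-/

noncomputable section

open MeasureTheory Function Finset Real
open scoped NNReal
open Literature.Probability.LatticeModels
open Literature.MathematicalPhysics.QuantumLattice hiding torusNorm
open Literature.MathematicalPhysics.QuantumFieldTheory hiding ZdEdge
open Summit.Ventures.YMGap.DSWindowZd

namespace Summit.Ventures.YMGap.RobustBall

/-! ### `ℤ⁴`, quarter modulus (RBS row 1v″ / T6VW, `SU(2)` cells) -/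

/-- **VAN HOVE = THE ONE STATE**, `SU(2)`, `ℤ⁴`, cell `(1 / 10, 0.173)` (tree coupling `1 / 20`): for every member of
`MemBallZdW (1/100) (173 / 500) (173 / 1000)`, every infinite-volume limit state of the perturbed torus states of its periodised family equals every
DLR state, and such limit states exist. [folklore] -/
theorem su2_vanHove_oneState_star_oneTenth :
    ∀ (W : Potential (ZdEdge 4) (SUN 2)) (hW : MemBallZdW (1 / 100) (173 / 500) (173 / 1000) W),
      (∀ μ ∈ perturbedLimitPoints (1 / 20) (periodisedFamilyS W hW.dependsOn hW.gaugeInvariant hW.continuous),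
        ∀ ν ∈ perturbedGibbsMeasuresS (d := 4) (fundamentalRep (Fin 2)) (1 / 20) W, μ = ν) ∧
      ∃ μ ∈ perturbedLimitPoints (1 / 20) (periodisedFamilyS W hW.dependsOn hW.gaugeInvariant hW.continuous),
        μ ∈ perturbedGibbsMeasuresS (d := 4) (fundamentalRep (Fin 2)) (1 / 20) W := by
  intro W hW
  have e : ((2 : ℕ) : ℝ) * (1 / 40 : ℝ) = 1 / 20 := by norm_num
  refine ⟨fun μ hμ ν hν => ?_, exists_limitState_onBallZdW _ hW⟩
  rw [← e] at hμ hν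
  exact oneState_onBallZdW su2_massGapOnBallZdW_star_oneTenth hW hμ hν

/-- **VAN HOVE = THE ONE STATE**, `SU(2)`, `ℤ⁴`, cell `(1 / 8, 0.148)` (tree coupling `1 / 16`): for every member of
`MemBallZdW (1/100) (37 / 125) (37 / 250)`, every infinite-volume limit state of the perturbed torus states of its periodised family equals every
DLR state, and such limit states exist. [folklore] -/
theorem su2_vanHove_oneState_star_oneEighth :
    ∀ (W : Potential (ZdEdge 4) (SUN 2)) (hW : MemBallZdW (1 / 100) (37 / 125) (37 / 250) W),
      (∀ μ ∈ perturbedLimitPoints (1 / 16) (periodisedFamilyS W hW.dependsOn hW.gaugeInvariant hW.continuous),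
        ∀ ν ∈ perturbedGibbsMeasuresS (d := 4) (fundamentalRep (Fin 2)) (1 / 16) W, μ = ν) ∧
      ∃ μ ∈ perturbedLimitPoints (1 / 16) (periodisedFamilyS W hW.dependsOn hW.gaugeInvariant hW.continuous),
        μ ∈ perturbedGibbsMeasuresS (d := 4) (fundamentalRep (Fin 2)) (1 / 16) W := by
  intro W hW
  have e : ((2 : ℕ) : ℝ) * (1 / 32 : ℝ) = 1 / 16 := by norm_num
  refine ⟨fun μ hμ ν hν => ?_, exists_limitState_onBallZdW _ hW⟩
  rw [← e] at hμ hν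
  exact oneState_onBallZdW su2_massGapOnBallZdW_star_oneEighth hW hμ hν

/-- **VAN HOVE = THE ONE STATE**, `SU(2)`, `ℤ⁴`, cell `(1 / 6, 0.111)` (tree coupling `1 / 12`): for every member of
`MemBallZdW (1/100) (111 / 500) (111 / 1000)`, every infinite-volume limit state of the perturbed torus states of its periodised family equals every
DLR state, and such limit states exist. [folklore] -/
theorem su2_vanHove_oneState_star_oneSixth :
    ∀ (W : Potential (ZdEdge 4) (SUN 2)) (hW : MemBallZdW (1 / 100) (111 / 500) (111 / 1000) W),
      (∀ μ ∈ perturbedLimitPoints (1 / 12) (periodisedFamilyS W hW.dependsOn hW.gaugeInvariant hW.continuous),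
        ∀ ν ∈ perturbedGibbsMeasuresS (d := 4) (fundamentalRep (Fin 2)) (1 / 12) W, μ = ν) ∧
      ∃ μ ∈ perturbedLimitPoints (1 / 12) (periodisedFamilyS W hW.dependsOn hW.gaugeInvariant hW.continuous),
        μ ∈ perturbedGibbsMeasuresS (d := 4) (fundamentalRep (Fin 2)) (1 / 12) W := by
  intro W hW
  have e : ((2 : ℕ) : ℝ) * (1 / 24 : ℝ) = 1 / 12 := by norm_num
  refine ⟨fun μ hμ ν hν => ?_, exists_limitState_onBallZdW _ hW⟩
  rw [← e] at hμ hν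
  exact oneState_onBallZdW su2_massGapOnBallZdW_star_oneSixth hW hμ hν

/-- **VAN HOVE = THE ONE STATE**, `SU(2)`, `ℤ⁴`, cell `(1 / 5, 0.086)` (tree coupling `1 / 10`): for every member of
`MemBallZdW (1/100) (43 / 250) (43 / 500)`, every infinite-volume limit state of the perturbed torus states of its periodised family equals every
DLR state, and such limit states exist. [folklore] -/
theorem su2_vanHove_oneState_star_oneFifth :
    ∀ (W : Potential (ZdEdge 4) (SUN 2)) (hW : MemBallZdW (1 / 100) (43 / 250) (43 / 500) W),
      (∀ μ ∈ perturbedLimitPoints (1 / 10) (periodisedFamilyS W hW.dependsOn hW.gaugeInvariant hW.continuous),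
        ∀ ν ∈ perturbedGibbsMeasuresS (d := 4) (fundamentalRep (Fin 2)) (1 / 10) W, μ = ν) ∧
      ∃ μ ∈ perturbedLimitPoints (1 / 10) (periodisedFamilyS W hW.dependsOn hW.gaugeInvariant hW.continuous),
        μ ∈ perturbedGibbsMeasuresS (d := 4) (fundamentalRep (Fin 2)) (1 / 10) W := by
  intro W hW
  have e : ((2 : ℕ) : ℝ) * (1 / 20 : ℝ) = 1 / 10 := by norm_num
  refine ⟨fun μ hμ ν hν => ?_, exists_limitState_onBallZdW _ hW⟩
  rw [← e] at hμ hν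
  exact oneState_onBallZdW su2_massGapOnBallZdW_star_oneFifth hW hμ hν

/-- **VAN HOVE = THE ONE STATE**, `SU(2)`, `ℤ⁴`, cell `(1 / 4, 0.054)` (tree coupling `1 / 8`): for every member of
`MemBallZdW (1/100) (27 / 250) (27 / 500)`, every infinite-volume limit state of the perturbed torus states of its periodised family equals every
DLR state, and such limit states exist. [folklore] -/
theorem su2_vanHove_oneState_star_oneQuarter :
    ∀ (W : Potential (ZdEdge 4) (SUN 2)) (hW : MemBallZdW (1 / 100) (27 / 250) (27 / 500) W),
      (∀ μ ∈ perturbedLimitPoints (1 / 8) (periodisedFamilyS W hW.dependsOn hW.gaugeInvariant hW.continuous),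
        ∀ ν ∈ perturbedGibbsMeasuresS (d := 4) (fundamentalRep (Fin 2)) (1 / 8) W, μ = ν) ∧
      ∃ μ ∈ perturbedLimitPoints (1 / 8) (periodisedFamilyS W hW.dependsOn hW.gaugeInvariant hW.continuous),
        μ ∈ perturbedGibbsMeasuresS (d := 4) (fundamentalRep (Fin 2)) (1 / 8) W := by
  intro W hW
  have e : ((2 : ℕ) : ℝ) * (1 / 16 : ℝ) = 1 / 8 := by norm_num
  refine ⟨fun μ hμ ν hν => ?_, exists_limitState_onBallZdW _ hW⟩
  rw [← e] at hμ hν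
  exact oneState_onBallZdW su2_massGapOnBallZdW_star_oneQuarter hW hμ hν

/-- **VAN HOVE = THE ONE STATE**, `SU(2)`, `ℤ⁴`, cell `(3 / 10, 0.027)` (tree coupling `3 / 20`): for every member of
`MemBallZdW (1/100) (27 / 500) (27 / 1000)`, every infinite-volume limit state of the perturbed torus states of its periodised family equals every
DLR state, and such limit states exist. [folklore] -/
theorem su2_vanHove_oneState_star_threeTenths :
    ∀ (W : Potential (ZdEdge 4) (SUN 2)) (hW : MemBallZdW (1 / 100) (27 / 500) (27 / 1000) W),
      (∀ μ ∈ perturbedLimitPoints (3 / 20) (periodisedFamilyS W hW.dependsOn hW.gaugeInvariant hW.continuous),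
        ∀ ν ∈ perturbedGibbsMeasuresS (d := 4) (fundamentalRep (Fin 2)) (3 / 20) W, μ = ν) ∧
      ∃ μ ∈ perturbedLimitPoints (3 / 20) (periodisedFamilyS W hW.dependsOn hW.gaugeInvariant hW.continuous),
        μ ∈ perturbedGibbsMeasuresS (d := 4) (fundamentalRep (Fin 2)) (3 / 20) W := by
  intro W hW
  have e : ((2 : ℕ) : ℝ) * (3 / 40 : ℝ) = 3 / 20 := by norm_num
  refine ⟨fun μ hμ ν hν => ?_, exists_limitState_onBallZdW _ hW⟩
  rw [← e] at hμ hν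
  exact oneState_onBallZdW su2_massGapOnBallZdW_star_threeTenths hW hμ hν

/-- **VAN HOVE = THE ONE STATE**, `SU(2)`, `ℤ⁴`, cell `(1 / 3, 0.011)` (tree coupling `1 / 6`): for every member of
`MemBallZdW (1/100) (11 / 500) (11 / 1000)`, every infinite-volume limit state of the perturbed torus states of its periodised family equals every
DLR state, and such limit states exist. [folklore] -/
theorem su2_vanHove_oneState_star_oneThird :
    ∀ (W : Potential (ZdEdge 4) (SUN 2)) (hW : MemBallZdW (1 / 100) (11 / 500) (11 / 1000) W),
      (∀ μ ∈ perturbedLimitPoints (1 / 6) (periodisedFamilyS W hW.dependsOn hW.gaugeInvariant hW.continuous),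
        ∀ ν ∈ perturbedGibbsMeasuresS (d := 4) (fundamentalRep (Fin 2)) (1 / 6) W, μ = ν) ∧
      ∃ μ ∈ perturbedLimitPoints (1 / 6) (periodisedFamilyS W hW.dependsOn hW.gaugeInvariant hW.continuous),
        μ ∈ perturbedGibbsMeasuresS (d := 4) (fundamentalRep (Fin 2)) (1 / 6) W := by
  intro W hW
  have e : ((2 : ℕ) : ℝ) * (1 / 12 : ℝ) = 1 / 6 := by norm_num
  refine ⟨fun μ hμ ν hν => ?_, exists_limitState_onBallZdW _ hW⟩
  rw [← e] at hμ hν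
  exact oneState_onBallZdW su2_massGapOnBallZdW_star_oneThird hW hμ hν

/-- **VAN HOVE = THE ONE STATE FOR EVERY `0 ≤ β_W ≤ 1/3` ON THE `1/3` BALL** (`MemBallZdW (1/100) (11 / 500) (11 / 1000)`, tree coupling
`2·(β_W/4)`; `su2_massGapOnBallZdW_star_upTo_oneThird` + `oneState_onBallZdW`). [folklore] -/
theorem su2_vanHove_oneState_star_upTo_oneThird {βW : ℝ} (h0 : 0 ≤ βW) (h : βW ≤ 1 / 3) :
    ∀ (W : Potential (ZdEdge 4) (SUN 2)) (hW : MemBallZdW (1 / 100) (11 / 500) (11 / 1000) W),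
      ∀ μ ∈ perturbedLimitPoints (((2 : ℕ) : ℝ) * (βW / 4)) (periodisedFamilyS W hW.dependsOn hW.gaugeInvariant hW.continuous),
        ∀ ν ∈ perturbedGibbsMeasuresS (d := 4) (fundamentalRep (Fin 2)) (((2 : ℕ) : ℝ) * (βW / 4)) W, μ = ν :=
  fun _ hW _ hμ _ hν => oneState_onBallZdW (su2_massGapOnBallZdW_star_upTo_oneThird h0 h) hW hμ hν

/-! ### `ℤ³` -/

/-- **VAN HOVE = THE ONE STATE**, `SU(2)`, `ℤ³`, cell `(1 / 4, 0.114)` (tree coupling `1 / 8`): for every member of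
`MemBallZdW (1/100) (57 / 250) (57 / 500)`, every infinite-volume limit state of the perturbed torus states of its periodised family equals every
DLR state, and such limit states exist. [folklore] -/
theorem su2_vanHove_oneState_dim3_star_oneQuarter :
    ∀ (W : Potential (ZdEdge 3) (SUN 2)) (hW : MemBallZdW (1 / 100) (57 / 250) (57 / 500) W),
      (∀ μ ∈ perturbedLimitPoints (1 / 8) (periodisedFamilyS W hW.dependsOn hW.gaugeInvariant hW.continuous),
        ∀ ν ∈ perturbedGibbsMeasuresS (d := 3) (fundamentalRep (Fin 2)) (1 / 8) W, μ = ν) ∧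
      ∃ μ ∈ perturbedLimitPoints (1 / 8) (periodisedFamilyS W hW.dependsOn hW.gaugeInvariant hW.continuous),
        μ ∈ perturbedGibbsMeasuresS (d := 3) (fundamentalRep (Fin 2)) (1 / 8) W := by
  intro W hW
  have e : ((2 : ℕ) : ℝ) * (1 / 16 : ℝ) = 1 / 8 := by norm_num
  refine ⟨fun μ hμ ν hν => ?_, exists_limitState_onBallZdW _ hW⟩
  rw [← e] at hμ hν
  exact oneState_onBallZdW su2_massGapOnBallZdW_dim3_star_oneQuarter hW hμ hν

/-- **VAN HOVE = THE ONE STATE**, `SU(2)`, `ℤ³`, cell `(3 / 10, 0.090)` (tree coupling `3 / 20`): for every member of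
`MemBallZdW (1/100) (9 / 50) (9 / 100)`, every infinite-volume limit state of the perturbed torus states of its periodised family equals every
DLR state, and such limit states exist. [folklore] -/
theorem su2_vanHove_oneState_dim3_star_threeTenths :
    ∀ (W : Potential (ZdEdge 3) (SUN 2)) (hW : MemBallZdW (1 / 100) (9 / 50) (9 / 100) W),
      (∀ μ ∈ perturbedLimitPoints (3 / 20) (periodisedFamilyS W hW.dependsOn hW.gaugeInvariant hW.continuous),
        ∀ ν ∈ perturbedGibbsMeasuresS (d := 3) (fundamentalRep (Fin 2)) (3 / 20) W, μ = ν) ∧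
      ∃ μ ∈ perturbedLimitPoints (3 / 20) (periodisedFamilyS W hW.dependsOn hW.gaugeInvariant hW.continuous),
        μ ∈ perturbedGibbsMeasuresS (d := 3) (fundamentalRep (Fin 2)) (3 / 20) W := by
  intro W hW
  have e : ((2 : ℕ) : ℝ) * (3 / 40 : ℝ) = 3 / 20 := by norm_num
  refine ⟨fun μ hμ ν hν => ?_, exists_limitState_onBallZdW _ hW⟩
  rw [← e] at hμ hν
  exact oneState_onBallZdW su2_massGapOnBallZdW_dim3_star_threeTenths hW hμ hν

/-- **VAN HOVE = THE ONE STATE**, `SU(2)`, `ℤ³`, cell `(2 / 5, 0.049)` (tree coupling `1 / 5`): for every member of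
`MemBallZdW (1/100) (49 / 500) (49 / 1000)`, every infinite-volume limit state of the perturbed torus states of its periodised family equals every
DLR state, and such limit states exist. [folklore] -/
theorem su2_vanHove_oneState_dim3_star_twoFifths :
    ∀ (W : Potential (ZdEdge 3) (SUN 2)) (hW : MemBallZdW (1 / 100) (49 / 500) (49 / 1000) W),
      (∀ μ ∈ perturbedLimitPoints (1 / 5) (periodisedFamilyS W hW.dependsOn hW.gaugeInvariant hW.continuous),
        ∀ ν ∈ perturbedGibbsMeasuresS (d := 3) (fundamentalRep (Fin 2)) (1 / 5) W, μ = ν) ∧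
      ∃ μ ∈ perturbedLimitPoints (1 / 5) (periodisedFamilyS W hW.dependsOn hW.gaugeInvariant hW.continuous),
        μ ∈ perturbedGibbsMeasuresS (d := 3) (fundamentalRep (Fin 2)) (1 / 5) W := by
  intro W hW
  have e : ((2 : ℕ) : ℝ) * (1 / 10 : ℝ) = 1 / 5 := by norm_num
  refine ⟨fun μ hμ ν hν => ?_, exists_limitState_onBallZdW _ hW⟩
  rw [← e] at hμ hν
  exact oneState_onBallZdW su2_massGapOnBallZdW_dim3_star_twoFifths hW hμ hν

/-- **VAN HOVE = THE ONE STATE**, `SU(2)`, `ℤ³`, cell `(1 / 2, 0.017)` (tree coupling `1 / 4`): for every member of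
`MemBallZdW (1/100) (17 / 500) (17 / 1000)`, every infinite-volume limit state of the perturbed torus states of its periodised family equals every
DLR state, and such limit states exist. [folklore] -/
theorem su2_vanHove_oneState_dim3_star_oneHalf :
    ∀ (W : Potential (ZdEdge 3) (SUN 2)) (hW : MemBallZdW (1 / 100) (17 / 500) (17 / 1000) W),
      (∀ μ ∈ perturbedLimitPoints (1 / 4) (periodisedFamilyS W hW.dependsOn hW.gaugeInvariant hW.continuous),
        ∀ ν ∈ perturbedGibbsMeasuresS (d := 3) (fundamentalRep (Fin 2)) (1 / 4) W, μ = ν) ∧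
      ∃ μ ∈ perturbedLimitPoints (1 / 4) (periodisedFamilyS W hW.dependsOn hW.gaugeInvariant hW.continuous),
        μ ∈ perturbedGibbsMeasuresS (d := 3) (fundamentalRep (Fin 2)) (1 / 4) W := by
  intro W hW
  have e : ((2 : ℕ) : ℝ) * (1 / 8 : ℝ) = 1 / 4 := by norm_num
  refine ⟨fun μ hμ ν hν => ?_, exists_limitState_onBallZdW _ hW⟩
  rw [← e] at hμ hν
  exact oneState_onBallZdW su2_massGapOnBallZdW_dim3_star_oneHalf hW hμ hν

/-! ### `ℤ⁴`, variance form -/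

/-- **VAN HOVE = THE ONE STATE**, `SU(2)`, `ℤ⁴` variance form, cell `(1 / 16, 0.308)` (tree coupling `1 / 32`): for every member of
`MemBallZdW (1/100) (77 / 125) (77 / 250)`, every infinite-volume limit state of the perturbed torus states of its periodised family equals every
DLR state, and such limit states exist. [folklore] -/
theorem su2_vanHove_oneState_starVar_oneSixteenth :
    ∀ (W : Potential (ZdEdge 4) (SUN 2)) (hW : MemBallZdW (1 / 100) (77 / 125) (77 / 250) W),
      (∀ μ ∈ perturbedLimitPoints (1 / 32) (periodisedFamilyS W hW.dependsOn hW.gaugeInvariant hW.continuous),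
        ∀ ν ∈ perturbedGibbsMeasuresS (d := 4) (fundamentalRep (Fin 2)) (1 / 32) W, μ = ν) ∧
      ∃ μ ∈ perturbedLimitPoints (1 / 32) (periodisedFamilyS W hW.dependsOn hW.gaugeInvariant hW.continuous),
        μ ∈ perturbedGibbsMeasuresS (d := 4) (fundamentalRep (Fin 2)) (1 / 32) W := by
  intro W hW
  have e : ((2 : ℕ) : ℝ) * (1 / 64 : ℝ) = 1 / 32 := by norm_num
  refine ⟨fun μ hμ ν hν => ?_, exists_limitState_onBallZdW _ hW⟩
  rw [← e] at hμ hν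
  exact oneState_onBallZdW su2_massGapOnBallZdW_starVar_oneSixteenth hW hμ hν

/-- **VAN HOVE = THE ONE STATE**, `SU(2)`, `ℤ⁴` variance form, cell `(1 / 10, 0.256)` (tree coupling `1 / 20`): for every member of
`MemBallZdW (1/100) (64 / 125) (32 / 125)`, every infinite-volume limit state of the perturbed torus states of its periodised family equals every
DLR state, and such limit states exist. [folklore] -/
theorem su2_vanHove_oneState_starVar_oneTenth :
    ∀ (W : Potential (ZdEdge 4) (SUN 2)) (hW : MemBallZdW (1 / 100) (64 / 125) (32 / 125) W),
      (∀ μ ∈ perturbedLimitPoints (1 / 20) (periodisedFamilyS W hW.dependsOn hW.gaugeInvariant hW.continuous),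
        ∀ ν ∈ perturbedGibbsMeasuresS (d := 4) (fundamentalRep (Fin 2)) (1 / 20) W, μ = ν) ∧
      ∃ μ ∈ perturbedLimitPoints (1 / 20) (periodisedFamilyS W hW.dependsOn hW.gaugeInvariant hW.continuous),
        μ ∈ perturbedGibbsMeasuresS (d := 4) (fundamentalRep (Fin 2)) (1 / 20) W := by
  intro W hW
  have e : ((2 : ℕ) : ℝ) * (1 / 40 : ℝ) = 1 / 20 := by norm_num
  refine ⟨fun μ hμ ν hν => ?_, exists_limitState_onBallZdW _ hW⟩
  rw [← e] at hμ hν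
  exact oneState_onBallZdW su2_massGapOnBallZdW_starVar_oneTenth hW hμ hν

/-- **VAN HOVE = THE ONE STATE**, `SU(2)`, `ℤ⁴` variance form, cell `(1 / 8, 0.222)` (tree coupling `1 / 16`): for every member of
`MemBallZdW (1/100) (111 / 250) (111 / 500)`, every infinite-volume limit state of the perturbed torus states of its periodised family equals every
DLR state, and such limit states exist. [folklore] -/
theorem su2_vanHove_oneState_starVar_oneEighth :
    ∀ (W : Potential (ZdEdge 4) (SUN 2)) (hW : MemBallZdW (1 / 100) (111 / 250) (111 / 500) W),
      (∀ μ ∈ perturbedLimitPoints (1 / 16) (periodisedFamilyS W hW.dependsOn hW.gaugeInvariant hW.continuous),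
        ∀ ν ∈ perturbedGibbsMeasuresS (d := 4) (fundamentalRep (Fin 2)) (1 / 16) W, μ = ν) ∧
      ∃ μ ∈ perturbedLimitPoints (1 / 16) (periodisedFamilyS W hW.dependsOn hW.gaugeInvariant hW.continuous),
        μ ∈ perturbedGibbsMeasuresS (d := 4) (fundamentalRep (Fin 2)) (1 / 16) W := by
  intro W hW
  have e : ((2 : ℕ) : ℝ) * (1 / 32 : ℝ) = 1 / 16 := by norm_num
  refine ⟨fun μ hμ ν hν => ?_, exists_limitState_onBallZdW _ hW⟩
  rw [← e] at hμ hν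
  exact oneState_onBallZdW su2_massGapOnBallZdW_starVar_oneEighth hW hμ hν

/-- **VAN HOVE = THE ONE STATE**, `SU(2)`, `ℤ⁴` variance form, cell `(1 / 6, 0.169)` (tree coupling `1 / 12`): for every member of
`MemBallZdW (1/100) (169 / 500) (169 / 1000)`, every infinite-volume limit state of the perturbed torus states of its periodised family equals every
DLR state, and such limit states exist. [folklore] -/
theorem su2_vanHove_oneState_starVar_oneSixth :
    ∀ (W : Potential (ZdEdge 4) (SUN 2)) (hW : MemBallZdW (1 / 100) (169 / 500) (169 / 1000) W),
      (∀ μ ∈ perturbedLimitPoints (1 / 12) (periodisedFamilyS W hW.dependsOn hW.gaugeInvariant hW.continuous),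
        ∀ ν ∈ perturbedGibbsMeasuresS (d := 4) (fundamentalRep (Fin 2)) (1 / 12) W, μ = ν) ∧
      ∃ μ ∈ perturbedLimitPoints (1 / 12) (periodisedFamilyS W hW.dependsOn hW.gaugeInvariant hW.continuous),
        μ ∈ perturbedGibbsMeasuresS (d := 4) (fundamentalRep (Fin 2)) (1 / 12) W := by
  intro W hW
  have e : ((2 : ℕ) : ℝ) * (1 / 24 : ℝ) = 1 / 12 := by norm_num
  refine ⟨fun μ hμ ν hν => ?_, exists_limitState_onBallZdW _ hW⟩
  rw [← e] at hμ hν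
  exact oneState_onBallZdW su2_massGapOnBallZdW_starVar_oneSixth hW hμ hν

/-- **VAN HOVE = THE ONE STATE**, `SU(2)`, `ℤ⁴` variance form, cell `(1 / 5, 0.128)` (tree coupling `1 / 10`): for every member of
`MemBallZdW (1/100) (32 / 125) (16 / 125)`, every infinite-volume limit state of the perturbed torus states of its periodised family equals every
DLR state, and such limit states exist. [folklore] -/
theorem su2_vanHove_oneState_starVar_oneFifth :
    ∀ (W : Potential (ZdEdge 4) (SUN 2)) (hW : MemBallZdW (1 / 100) (32 / 125) (16 / 125) W),
      (∀ μ ∈ perturbedLimitPoints (1 / 10) (periodisedFamilyS W hW.dependsOn hW.gaugeInvariant hW.continuous),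
        ∀ ν ∈ perturbedGibbsMeasuresS (d := 4) (fundamentalRep (Fin 2)) (1 / 10) W, μ = ν) ∧
      ∃ μ ∈ perturbedLimitPoints (1 / 10) (periodisedFamilyS W hW.dependsOn hW.gaugeInvariant hW.continuous),
        μ ∈ perturbedGibbsMeasuresS (d := 4) (fundamentalRep (Fin 2)) (1 / 10) W := by
  intro W hW
  have e : ((2 : ℕ) : ℝ) * (1 / 20 : ℝ) = 1 / 10 := by norm_num
  refine ⟨fun μ hμ ν hν => ?_, exists_limitState_onBallZdW _ hW⟩
  rw [← e] at hμ hν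
  exact oneState_onBallZdW su2_massGapOnBallZdW_starVar_oneFifth hW hμ hν

end Summit.Ventures.YMGap.RobustBall

end
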